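import Summits.QuantumFields.YangMills.Theorems.DiagonalMirrorRPR.Negative.PhantomFunctional
import Literature.MathematicalPhysics.QuantumFieldTheory.OSDistributionSpace
import Literature.MathematicalPhysics.QuantumFieldTheory.OSData

/-!
# `DiagonalMirrorRPR` — the phantom family carries `W₁ ∖ hconv` (negative-lemma infrastructure, part 2 of 3)

Supports crux item `stmt-QuantumFields-10604`. The PHANTOM FAMILY `phantomFamily = vacuumFamily + phantom`
(`phantom 3 = T₃` of `PhantomFunctional`, `0` in other degrees) satisfies every clause of the crux's curvature
package `W₁` except lattice convergence: E0 (`phantomFamily_isNormalized`, `phantomFamily_isHermitian`), E0'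
(`phantomFamily_hasLinearGrowth`, via `SchwingerFamily.exists_bound_holds`), E2 along `e₀`
(`phantomFamily_isReflectionPositive`), E3 (`phantomFamily_isSymmetric`), E4
(`phantomFamily_hasClusterProperty`), translation invariance and invariance under EVERY signed permutation on
all test functions (`phantomFamily_translateMulti`, `phantomFamily_linActMulti`), and every mass gap
(`phantomFamily_hasMassGap`). Mechanism: each e₀-based clause tests only time-separated functions
(`IsTimeSeparated` bookkeeping: time-ordered ⇒ separated; `θF*`, spatial / forward-time translates and the
appended tensors `θF* ⊗ G` stay separated), on which the phantom vanishes (`T₃_eq_zero_of_isTimeSeparated`),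
so the phantom family agrees there with the vacuum family, whose package is the tree's
`OSAxiomsSchwinger.trivial` / `OSData.vacuum_hasMassGap`.
-/

noncomputable section

open scoped SchwartzMap ComplexConjugate InnerProductSpace
open MeasureTheory Filter Topology Complex
open Literature.MathematicalPhysics.QuantumLattice Literature.MathematicalPhysics.AQFT
  Literature.MathematicalPhysics.QuantumFieldTheory

namespace Summit.QuantumFields.YangMills.Theorems.DiagonalMirrorRPR.Negative

namespace Phantom

/-! ## 5. The phantom family `𝔖 = vacuum + T₃` and its package -/

/-- The degree-3 phantom as a Schwinger family (zero in all other degrees). [folklore] -/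
def phantom : SchwingerFamily E4
  | 3 => T₃
  | _ => 0

/-- In degree `3` the phantom is `T₃`. [folklore] -/
@[simp] theorem phantom_three : phantom 3 = T₃ := rfl

/-- In degrees `≠ 3` the phantom vanishes. [folklore] -/
theorem phantom_of_ne_three {n : ℕ} (hn : n ≠ 3) : phantom n = 0 := by
  match n, hn with
  | 0, _ => rfl
  | 1, _ => rfl
  | 2, _ => rfl
  | 3, h => exact absurd rfl h
  | _ + 4, _ => rfl

/-- **The phantom family**: vacuum plus the degree-3 phantom. [folklore] -/
def phantomFamily : SchwingerFamily E4 := fun n => vacuumFamily n + phantom n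

/-- Unfolding the phantom family. [folklore] -/
theorem phantomFamily_apply {n : ℕ} (F : 𝓢((Fin n → E4), ℂ)) :
    phantomFamily n F = vacuumFamily n F + phantom n F := rfl

/-- Unfolding the vacuum family. [folklore] -/
theorem vacuumFamily_apply {n : ℕ} (F : 𝓢((Fin n → E4), ℂ)) :
    vacuumFamily n F = if n = 0 then F 0 else 0 :=
  LabelledSchwingerFamily.trivial_apply _ _ _ _

/-- The phantom vanishes on time-separated test functions, in every degree. [folklore] -/
theorem phantom_apply_eq_zero_of_isTimeSeparated {n : ℕ} {F : 𝓢((Fin n → E4), ℂ)} (hF : IsTimeSeparated F) :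
    phantom n F = 0 := by
  by_cases hn : n = 3
  · subst hn
    exact T₃_eq_zero_of_isTimeSeparated hF
  · rw [phantom_of_ne_three hn]; rfl

/-- Unfolding the phantom family. [folklore] -/
theorem phantomFamily_apply_of_isTimeSeparated {n : ℕ} {F : 𝓢((Fin n → E4), ℂ)} (hF : IsTimeSeparated F) :
    phantomFamily n F = LabelledSchwingerFamily.trivial Unit E4 n (fun _ => ()) F := by
  rw [phantomFamily_apply, phantom_apply_eq_zero_of_isTimeSeparated hF, add_zero]; rfl

/-! #### Time-separation bookkeeping -/

section IsTimeSeparatedLemmas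

variable {n m : ℕ}

/-- All times negative wherever `F ≠ 0`. [folklore] -/
def IsNegTime (F : 𝓢((Fin n → E4), ℂ)) : Prop := ∀ x, F x ≠ 0 → ∀ i, x i 0 < 0

/-- All times positive wherever `F ≠ 0`. [folklore] -/
def IsPosTime (F : 𝓢((Fin n → E4), ℂ)) : Prop := ∀ x, F x ≠ 0 → ∀ i, 0 < x i 0

/-- A point where `F ≠ 0` lies in `tsupport F`. [folklore] -/
theorem mem_tsupport_of_ne {F : 𝓢((Fin n → E4), ℂ)} {x : Fin n → E4} (hx : F x ≠ 0) :
    x ∈ tsupport (F : (Fin n → E4) → ℂ) :=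
  subset_tsupport _ (Function.mem_support.2 hx)

/-- Time-ordered test functions are time-separated. [folklore] -/
theorem IsTimeOrdered.isTimeSeparated {F : 𝓢((Fin n → E4), ℂ)} (hF : IsTimeOrdered F) : IsTimeSeparated F :=
  fun _ hx => (hF (mem_tsupport_of_ne hx)).2.injective

/-- Time-ordered test functions live at positive times. [folklore] -/
theorem IsTimeOrdered.isPosTime {F : 𝓢((Fin n → E4), ℂ)} (hF : IsTimeOrdered F) : IsPosTime F :=
  fun _ hx => (hF (mem_tsupport_of_ne hx)).1

/-- Where `θF* ≠ 0`, `F ≠ 0` at the reflected reversed point. [folklore] -/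
theorem osAdjoint_ne_zero {F : 𝓢((Fin n → E4), ℂ)} {x : Fin n → E4} (hx : osAdjoint F x ≠ 0) :
    F (fun i => timeReflection 4 (x (Fin.rev i))) ≠ 0 := by
  rw [osAdjoint_apply] at hx
  exact fun h => hx (by rw [h, map_zero])

/-- `θF*` of a time-separated `F` is time-separated. [folklore] -/
theorem IsTimeSeparated.osAdjoint {F : 𝓢((Fin n → E4), ℂ)} (hF : IsTimeSeparated F) : IsTimeSeparated (osAdjoint F) := by
  intro x hx a b hab
  have hinj := hF _ (osAdjoint_ne_zero hx)
  have h : (fun i => (timeReflection 4 (x (Fin.rev i))) 0) (Fin.rev a) =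
      (fun i => (timeReflection 4 (x (Fin.rev i))) 0) (Fin.rev b) := by
    simp only [timeReflection_apply, Fin.rev_rev, ↓reduceIte]
    exact congrArg Neg.neg hab
  simpa using hinj h

/-- `θF*` of a positive-time `F` lives at negative times. [folklore] -/
theorem IsPosTime.isNegTime_osAdjoint {F : 𝓢((Fin n → E4), ℂ)} (hF : IsPosTime F) : IsNegTime (osAdjoint F) := by
  intro x hx i
  have h := hF _ (osAdjoint_ne_zero hx) (Fin.rev i)
  simp only [timeReflection_apply, Fin.rev_rev, ↓reduceIte] at h
  linarith

/-- Diagonal translations preserve time-separation. [folklore] -/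
theorem IsTimeSeparated.translateMulti {F : 𝓢((Fin n → E4), ℂ)} (hF : IsTimeSeparated F) (a : E4) :
    IsTimeSeparated (translateMulti a F) := by
  intro x hx i j hij
  rw [translateMulti_apply] at hx
  refine hF _ hx ?_
  dsimp only at hij ⊢
  simp only [PiLp.sub_apply, hij]

/-- Spatial translations preserve positive times. [folklore] -/
theorem IsPosTime.translateMulti_spatial {F : 𝓢((Fin n → E4), ℂ)} (hF : IsPosTime F) {a : E4} (ha : a 0 = 0)
    (t : ℝ) : IsPosTime (translateMulti (t • a) F) := by
  intro x hx i
  rw [translateMulti_apply] at hx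
  have h := hF _ hx i
  simp only [PiLp.sub_apply, PiLp.smul_apply, ha, smul_eq_mul, mul_zero, sub_zero] at h
  exact h

/-- Forward time translations preserve positive times. [folklore] -/
theorem IsPosTime.translateMulti_time {F : 𝓢((Fin n → E4), ℂ)} (hF : IsPosTime F) {t : ℝ} (ht : 0 ≤ t) :
    IsPosTime (translateMulti (EuclideanSpace.single 0 t) F) := by
  intro x hx i
  rw [translateMulti_apply] at hx
  have h := hF _ hx i
  simp only [PiLp.sub_apply, PiLp.single_apply, ↓reduceIte] at h
  linarith

/-- Appending a negative-time block to a positive-time block keeps the times separated. [folklore] -/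
theorem IsTimeSeparated.append {H : 𝓢((Fin (n + m) → E4), ℂ)} {A : 𝓢((Fin n → E4), ℂ)} {B : 𝓢((Fin m → E4), ℂ)}
    (hH : IsAppendTensorOf H A B) (hA : IsTimeSeparated A) (hA' : IsNegTime A) (hB : IsTimeSeparated B) (hB' : IsPosTime B) :
    IsTimeSeparated H := by
  intro x hx
  rw [hH x] at hx
  have hA0 : A (x ∘ Fin.castAdd m) ≠ 0 := left_ne_zero_of_mul hx
  have hB0 : B (x ∘ Fin.natAdd n) ≠ 0 := right_ne_zero_of_mul hx
  intro a b hab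
  induction a using Fin.addCases with
  | left a =>
    induction b using Fin.addCases with
    | left b => exact congrArg _ (hA _ hA0 (a₁ := a) (a₂ := b) hab)
    | right b =>
      exfalso
      have h1 := hA' _ hA0 a
      have h2 := hB' _ hB0 b
      simp only [Function.comp_apply] at h1 h2
      change x (Fin.castAdd m a) 0 = x (Fin.natAdd n b) 0 at hab
      linarith
  | right a =>
    induction b using Fin.addCases with
    | left b =>
      exfalso
      have h1 := hB' _ hB0 a
      have h2 := hA' _ hA0 b
      simp only [Function.comp_apply] at h1 h2
      change x (Fin.natAdd n a) 0 = x (Fin.castAdd m b) 0 at hab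
      linarith
    | right b => exact congrArg _ (hB _ hB0 (a₁ := a) (a₂ := b) hab)

/-- The E2 / E4 / mass-gap test functions `θF* ⊗ G` are time-separated. [folklore] -/
theorem isTimeSeparated_of_appendTensor {H : 𝓢((Fin (n + m) → E4), ℂ)} {F : 𝓢((Fin n → E4), ℂ)}
    {G : 𝓢((Fin m → E4), ℂ)} (hF : IsTimeOrdered F) (hG : IsTimeSeparated G) (hG' : IsPosTime G)
    (hH : IsAppendTensorOf H (osAdjoint F) G) : IsTimeSeparated H :=
  IsTimeSeparated.append hH (IsTimeOrdered.isTimeSeparated hF).osAdjoint (IsTimeOrdered.isPosTime hF).isNegTime_osAdjoint hG hG'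

end IsTimeSeparatedLemmas

/-! ### The clauses of `W₁ ∖ hconv` hold for the phantom family -/

/-- E0 (normalisation) for the phantom family. [folklore] -/
theorem phantomFamily_isNormalized : phantomFamily.toLabelled.IsNormalized := by
  intro k F
  rw [SchwingerFamily.toLabelled_apply, phantomFamily_apply, vacuumFamily_apply, if_pos rfl,
    phantom_of_ne_three (by decide)]
  simp only [zero_apply, add_zero]
  exact congrArg F (Subsingleton.elim _ _)

/-- E0 (hermiticity) for the phantom family. [folklore] -/
theorem phantomFamily_isHermitian : phantomFamily.toLabelled.IsHermitian := by
  intro n k F hF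
  rw [SchwingerFamily.toLabelled_apply, SchwingerFamily.toLabelled_apply,
    phantomFamily_apply_of_isTimeSeparated (IsTimeOrdered.isTimeSeparated hF),
    phantomFamily_apply_of_isTimeSeparated (IsTimeOrdered.isTimeSeparated hF).osAdjoint]
  exact (OSAxiomsSchwinger.trivial (ι := Unit) (d := 4)).hermitian n k F hF

/-- E0' (linear growth) for the phantom family (only degrees `0` and `3` are non-zero). [folklore] -/
theorem phantomFamily_hasLinearGrowth : phantomFamily.toLabelled.HasLinearGrowth := by
  intro T
  obtain ⟨s₃, C₃, h₃⟩ := SchwingerFamily.exists_bound_holds phantomFamily 3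
  refine ⟨s₃ + 1, max C₃ 0 + 1, 0, fun n k _ F _ => ?_⟩
  rw [Real.rpow_zero, mul_one, SchwingerFamily.toLabelled_apply]
  have hsn : 0 ≤ schwartzNorm (n * (s₃ + 1)) F := schwartzNorm_nonneg _ _
  by_cases hn3 : n = 3
  · subst hn3
    have hα : 0 ≤ max C₃ 0 + 1 := by have := le_max_right C₃ 0; linarith
    calc ‖phantomFamily 3 F‖ ≤ C₃ * schwartzNorm s₃ F := h₃ F
      _ ≤ (max C₃ 0 + 1) * schwartzNorm s₃ F :=
          mul_le_mul_of_nonneg_right (by linarith [le_max_left C₃ 0]) (schwartzNorm_nonneg _ _)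
      _ ≤ (max C₃ 0 + 1) * schwartzNorm (3 * (s₃ + 1)) F :=
          mul_le_mul_of_nonneg_left (schwartzNorm_mono (by omega) F) hα
  · rw [phantomFamily_apply, phantom_of_ne_three hn3, vacuumFamily_apply]
    split_ifs with hn0
    · subst hn0
      simp only [zero_apply, add_zero]
      calc ‖F 0‖ ≤ schwartzNorm (0 * (s₃ + 1)) F := norm_le_schwartzNorm _ F 0
        _ ≤ (max C₃ 0 + 1) * schwartzNorm (0 * (s₃ + 1)) F :=
            le_mul_of_one_le_left (schwartzNorm_nonneg _ _) (by linarith [le_max_right C₃ 0])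
    · simp only [zero_apply, add_zero, norm_zero]
      exact mul_nonneg (by have := le_max_right C₃ 0; linarith) hsn

/-- E2 along `e₀` for the phantom family: every E2 test function is time-separated, so the phantom is invisible. [folklore] -/
theorem phantomFamily_isReflectionPositive : phantomFamily.toLabelled.IsReflectionPositive := by
  intro N deg lab F hF H hH
  have hterm : ∀ i j, phantomFamily.toLabelled (deg i + deg j) (Fin.append (lab i ∘ Fin.rev) (lab j)) (H i j) =
      LabelledSchwingerFamily.trivial Unit E4 (deg i + deg j) (Fin.append (lab i ∘ Fin.rev) (lab j)) (H i j) := by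
    intro i j
    rw [SchwingerFamily.toLabelled_apply, phantomFamily_apply_of_isTimeSeparated
      (isTimeSeparated_of_appendTensor (hF i) (IsTimeOrdered.isTimeSeparated (hF j)) (IsTimeOrdered.isPosTime (hF j)) (hH i j))]
  simp only [hterm]
  exact (OSAxiomsSchwinger.trivial (ι := Unit) (d := 4)).reflectionPositive N deg lab F hF H hH

/-- E3 for the phantom family. [folklore] -/
theorem phantomFamily_isSymmetric : phantomFamily.toLabelled.IsSymmetric := by
  intro n k π F _
  rw [SchwingerFamily.toLabelled_apply, SchwingerFamily.toLabelled_apply, phantomFamily_apply,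
    phantomFamily_apply, vacuumFamily_apply, vacuumFamily_apply]
  congr 1
  · split_ifs with hn
    · subst hn; rw [permTest_apply]; exact congrArg F (Subsingleton.elim _ _)
    · rfl
  · by_cases hn : n = 3
    · subst hn; exact T₃_permTest π F
    · rw [phantom_of_ne_three hn]; rfl

/-- E4 for the phantom family. [folklore] -/
theorem phantomFamily_hasClusterProperty : phantomFamily.toLabelled.HasClusterProperty := by
  intro n m k k' F G hF hG a ha0 ha H hH
  have h1 : ∀ t, phantomFamily.toLabelled (n + m) (Fin.append (k ∘ Fin.rev) k') (H t) =
      LabelledSchwingerFamily.trivial Unit E4 (n + m) (Fin.append (k ∘ Fin.rev) k') (H t) := fun t => by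
    rw [SchwingerFamily.toLabelled_apply, phantomFamily_apply_of_isTimeSeparated
      (isTimeSeparated_of_appendTensor hF ((IsTimeOrdered.isTimeSeparated hG).translateMulti _)
        ((IsTimeOrdered.isPosTime hG).translateMulti_spatial ha0 t) (hH t))]
  have h2 : phantomFamily.toLabelled n (k ∘ Fin.rev) (osAdjoint F) =
      LabelledSchwingerFamily.trivial Unit E4 n (k ∘ Fin.rev) (osAdjoint F) := by
    rw [SchwingerFamily.toLabelled_apply, phantomFamily_apply_of_isTimeSeparated (IsTimeOrdered.isTimeSeparated hF).osAdjoint]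
  have h3 : phantomFamily.toLabelled m k' G = LabelledSchwingerFamily.trivial Unit E4 m k' G := by
    rw [SchwingerFamily.toLabelled_apply, phantomFamily_apply_of_isTimeSeparated (IsTimeOrdered.isTimeSeparated hG)]
  simp only [h1, h2, h3]
  exact (OSAxiomsSchwinger.trivial (ι := Unit) (d := 4)).cluster n m k k' F G hF hG a ha0 ha H hH

/-- Translation invariance of the phantom family (all test functions). [folklore] -/
theorem phantomFamily_translateMulti (n : ℕ) (a : E4) (F : 𝓢((Fin n → E4), ℂ)) :
    phantomFamily n (translateMulti a F) = phantomFamily n F := by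
  rw [phantomFamily_apply, phantomFamily_apply, vacuumFamily_apply, vacuumFamily_apply]
  congr 1
  · split_ifs with hn
    · subst hn; rw [translateMulti_apply]; exact congrArg F (Subsingleton.elim _ _)
    · rfl
  · by_cases hn : n = 3
    · subst hn; exact T₃_translateMulti a F
    · rw [phantom_of_ne_three hn]; rfl

/-- Invariance of the phantom family under every signed permutation (all test functions). [folklore] -/
theorem phantomFamily_linActMulti (R : SignedPerm) (n : ℕ) (F : 𝓢((Fin n → E4), ℂ)) :
    phantomFamily n (linActMulti R.1 F) = phantomFamily n F := by
  rw [phantomFamily_apply, phantomFamily_apply, vacuumFamily_apply, vacuumFamily_apply]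
  congr 1
  · split_ifs with hn
    · subst hn; rw [linActMulti_apply]; exact congrArg F (Subsingleton.elim _ _)
    · rfl
  · by_cases hn : n = 3
    · subst hn; exact T₃_linActMulti R F
    · rw [phantom_of_ne_three hn]; rfl

/-- The phantom family has every mass gap (the phantom is invisible to the clustered quantities). [folklore] -/
theorem phantomFamily_hasMassGap (Δ : ℝ) : phantomFamily.toLabelled.HasMassGap Δ := by
  intro n m k k' F G hF hG
  obtain ⟨C, hC⟩ := OSData.vacuum_hasMassGap (ι := Unit) (d := 4) Δ n m k k' F G hF hG
  refine ⟨C, fun t ht H hH => ?_⟩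
  have h1 : phantomFamily.toLabelled (n + m) (Fin.append (k ∘ Fin.rev) k') H =
      LabelledSchwingerFamily.trivial Unit E4 (n + m) (Fin.append (k ∘ Fin.rev) k') H := by
    rw [SchwingerFamily.toLabelled_apply, phantomFamily_apply_of_isTimeSeparated
      (isTimeSeparated_of_appendTensor hF ((IsTimeOrdered.isTimeSeparated hG).translateMulti _)
        ((IsTimeOrdered.isPosTime hG).translateMulti_time ht) hH)]
  have h2 : phantomFamily.toLabelled n (k ∘ Fin.rev) (osAdjoint F) =
      LabelledSchwingerFamily.trivial Unit E4 n (k ∘ Fin.rev) (osAdjoint F) := by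
    rw [SchwingerFamily.toLabelled_apply, phantomFamily_apply_of_isTimeSeparated (IsTimeOrdered.isTimeSeparated hF).osAdjoint]
  have h3 : phantomFamily.toLabelled m k' G = LabelledSchwingerFamily.trivial Unit E4 m k' G := by
    rw [SchwingerFamily.toLabelled_apply, phantomFamily_apply_of_isTimeSeparated (IsTimeOrdered.isTimeSeparated hG)]
  rw [h1, h2, h3]
  exact hC t ht H hH


end Phantom

end Summit.QuantumFields.YangMills.Theorems.DiagonalMirrorRPR.Negative
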